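import Summits.MatrixMultiplication.MatrixMultiplication.Theses.HyperbolicRankMethods

/-!
# Birth skeleton (BC3) for the piece `HypQuotientSquaring` (stmt-MatrixMultiplication-17704)
of the BC2 redirect of `HypSuperquadratic` (stmt-MatrixMultiplication-10086), route HyperbolicRankMethods.

Line `squaring-regimes`: the squaring law `Q(n²) ≥ Q(n)²/C₀` splits by REGIME of the input method.
* `stub_flatteningMethod` — the hyperbolic class is inhabited at quotient `m²` on every `⟨m,m,m⟩`
  (`k·m² ≤ Rank_h(Φ⟨m,m,m⟩)`, `k ≥ 1`): the Hermitian doubling `[[0,F],[F^*,0]]` of the flattening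
  `F : A^* → B ⊗ C` with `h = det` on Hermitian `(m²+m⁴)`-matrices, `e = I` (Gårding rank = matrix
  rank, rank-one ↦ 2, `⟨m,m,m⟩ ↦ 2m²`). TRUE; a genuine Lean construction (size M/L). It is what
  makes the squaring law hold in the weak regime `r ≤ C₁ k n²` with `C₀ = C₁²`, and it is the BC5
  "inhabited in kind" witness of the whole route.
* `stub_strongSquaring` — the CORE: squaring with constant loss `C₂` for inputs in the strong
  regime `C₁·k·n² < r` (beyond every matrix-rank method from `C₁ = 12` on). Open; this is where a
  Gårding-rank-preserving tensor square of hyperbolic polynomials with rank-one control on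
  `Seg(ℂ^(n²×n²))` is needed.
* `HypQuotientSquaring_of` — the composition (case split on the regime, `C₀ := C₁² + C₂`, and the
  arithmetic `r²k' ≤ (C₁kn²)²k' = C₁²·(k'n⁴)·k² ≤ C₁²·r'·k²`).
Sorries ONLY inside the two stubs.
-/

namespace Summit.MatrixMultiplication.MatrixMultiplication.Cruxes.HypSuperquadratic.SquaringRegimes

open Summit.MatrixMultiplication.MatrixMultiplication.Theses.HyperbolicRankMethods

/-- STUB (true, constructive, size M/L): the Hermitian-doubled flattening is a hyperbolic rank
method of quotient `m²` at every `⟨m,m,m⟩`, `m ≥ 1`. -/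
theorem stub_flatteningMethod : ∀ m : ℕ, 1 ≤ m → ∃ (N d k : ℕ) (h : MvPolynomial (Fin N) ℝ) (e : Fin N → ℝ) (Φ : (Fin m × Fin m → Fin m × Fin m → Fin m × Fin m → ℂ) →ₗ[ℝ] (Fin N → ℝ)), h.IsHomogeneous d ∧ MvPolynomial.eval e h ≠ 0 ∧ (∀ w : Fin N → ℝ, Multiset.card (MvPolynomial.aeval (fun i => Polynomial.C (w i) + Polynomial.C (e i) * Polynomial.X) h).roots = d) ∧ (∀ u v : Fin N → ℝ, (d - (MvPolynomial.aeval (fun i => Polynomial.C ((u + v) i) + Polynomial.C (e i) * Polynomial.X) h).natTrailingDegree) ≤ (d - (MvPolynomial.aeval (fun i => Polynomial.C (u i) + Polynomial.C (e i) * Polynomial.X) h).natTrailingDegree) + (d - (MvPolynomial.aeval (fun i => Polynomial.C (v i) + Polynomial.C (e i) * Polynomial.X) h).natTrailingDegree)) ∧ (∀ w u v : Fin m × Fin m → ℂ, (d - (MvPolynomial.aeval (fun i => Polynomial.C ((Φ (Literature.Computability.AlgebraicComplexity.triad w u v)) i) + Polynomial.C (e i) * Polynomial.X) h).natTrailingDegree)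 ≤ k) ∧ 1 ≤ k ∧ k * m ^ 2 ≤ (d - (MvPolynomial.aeval (fun i => Polynomial.C ((Φ (Literature.Computability.AlgebraicComplexity.matMulTensor ℂ m m m)) i) + Polynomial.C (e i) * Polynomial.X) h).natTrailingDegree) := by
  sorry

/-- STUB (the core, open): Kronecker squaring with constant loss in the strong regime
`C₁·k·n² < Rank_h(Φ⟨n,n,n⟩)`. -/
theorem stub_strongSquaring : ∃ C₁ C₂ : ℕ, ∀ (n : ℕ) (N d k : ℕ) (h : MvPolynomial (Fin N) ℝ) (e : Fin N → ℝ) (Φ : (Fin n × Fin n → Fin n × Fin n → Fin n × Fin n → ℂ) →ₗ[ℝ] (Fin N → ℝ)), 2 ≤ n → h.IsHomogeneous d → MvPolynomial.eval e h ≠ 0 → (∀ w : Fin N → ℝ, Multiset.card (MvPolynomial.aeval (fun i => Polynomial.C (w i) + Polynomial.C (e i) * Polynomial.X) h).roots = d) → (∀ u v : Fin N → ℝ, (d - (MvPolynomial.aeval (fun i => Polynomial.C ((u + v) i) + Polynomial.C (e i) * Polynomial.X) h).natTrailingDegree) ≤ (d - (MvPolynomial.aeval (fun i => Polynomial.C (u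 i) + Polynomial.C (e i) * Polynomial.X) h).natTrailingDegree) + (d - (MvPolynomial.aeval (fun i => Polynomial.C (v i) + Polynomial.C (e i) * Polynomial.X) h).natTrailingDegree)) → (∀ w u v : Fin n × Fin n → ℂ, (d - (MvPolynomial.aeval (fun i => Polynomial.C ((Φ (Literature.Computability.AlgebraicComplexity.triad w u v)) i) + Polynomial.C (e i) * Polynomial.X) h).natTrailingDegree) ≤ k) → 1 ≤ k → C₁ * k * n ^ 2 < (d - (MvPolynomial.aeval (fun i => Polynomial.C ((Φ (Literature.Computability.AlgebraicComplexity.matMulTensor ℂ n n n)) i) + Polynomial.C (e i) * Polynomial.X) h).natTrailingDegree) → ∃ (N' d' k' : ℕ) (h' : MvPolynomial (Fin N') ℝ) (e' : Fin N' → ℝ) (Φ' : (Fin (n ^ 2) × Fin (n ^ 2) → Fin (n ^ 2) × Fin (n ^ 2) → Fin (n ^ 2) × Fin (n ^ 2) → ℂ) →ₗ[ℝ] (Fin N' → ℝ)), h'.IsHomogeneous d' ∧ MvPolynomial.eval e' h' ≠ 0 ∧ (∀ w : Fin N' → ℝ, Multiset.card (MvPolynomial.aeval (fun i => Polynomial.C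 (w i) + Polynomial.C (e' i) * Polynomial.X) h').roots = d') ∧ (∀ u v : Fin N' → ℝ, (d' - (MvPolynomial.aeval (fun i => Polynomial.C ((u + v) i) + Polynomial.C (e' i) * Polynomial.X) h').natTrailingDegree) ≤ (d' - (MvPolynomial.aeval (fun i => Polynomial.C (u i) + Polynomial.C (e' i) * Polynomial.X) h').natTrailingDegree) + (d' - (MvPolynomial.aeval (fun i => Polynomial.C (v i) + Polynomial.C (e' i) * Polynomial.X) h').natTrailingDegree)) ∧ (∀ w u v : Fin (n ^ 2) × Fin (n ^ 2) → ℂ, (d' - (MvPolynomial.aeval (fun i => Polynomial.C ((Φ' (Literature.Computability.AlgebraicComplexity.triad w u v)) i) + Polynomial.C (e' i) * Polynomial.X) h').natTrailingDegree) ≤ k') ∧ 1 ≤ k' ∧ (d - (MvPolynomial.aeval (fun i => Polynomial.C ((Φ (Literature.Computability.AlgebraicComplexity.matMulTensor ℂ n n n)) i) + Polynomial.C (e i) * Polynomial.X) h).natTrailingDegree) ^ 2 * k' ≤ C₂ * (d' - (MvPolynomial.aeval (fun i => Polynomial.C ((Φ' (Literature.Computability.AlgebraicComplexity.matMulTensor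 ℂ (n ^ 2) (n ^ 2) (n ^ 2))) i) + Polynomial.C (e' i) * Polynomial.X) h').natTrailingDegree) * k ^ 2 := by
  sorry

/-- COMPOSITION with explicit hypotheses (kernel-checked, sorry-free): the two regimes give
`HypQuotientSquaring` with `C₀ = C₁² + C₂`. -/
theorem hypQuotientSquaring_of_regimes : (∀ m : ℕ, 1 ≤ m → ∃ (N d k : ℕ) (h : MvPolynomial (Fin N) ℝ) (e : Fin N → ℝ) (Φ : (Fin m × Fin m → Fin m × Fin m → Fin m × Fin m → ℂ) →ₗ[ℝ] (Fin N → ℝ)), h.IsHomogeneous d ∧ MvPolynomial.eval e h ≠ 0 ∧ (∀ w : Fin N → ℝ, Multiset.card (MvPolynomial.aeval (fun i => Polynomial.C (w i) + Polynomial.C (e i) * Polynomial.X) h).roots = d) ∧ (∀ u v : Fin N → ℝ, (d - (MvPolynomial.aeval (fun i => Polynomial.C ((u + v) i) + Polynomial.C (e i) * Polynomial.X) h).natTrailingDegree) ≤ (d - (MvPolynomial.aeval (fun i => Polynomial.C (u i) + Polynomial.C (e i) * Polynomial.X) h).natTrailingDegree) + (d - (MvPolynomial.aeval (fun i => Polynomial.C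 (v i) + Polynomial.C (e i) * Polynomial.X) h).natTrailingDegree)) ∧ (∀ w u v : Fin m × Fin m → ℂ, (d - (MvPolynomial.aeval (fun i => Polynomial.C ((Φ (Literature.Computability.AlgebraicComplexity.triad w u v)) i) + Polynomial.C (e i) * Polynomial.X) h).natTrailingDegree) ≤ k) ∧ 1 ≤ k ∧ k * m ^ 2 ≤ (d - (MvPolynomial.aeval (fun i => Polynomial.C ((Φ (Literature.Computability.AlgebraicComplexity.matMulTensor ℂ m m m)) i) + Polynomial.C (e i) * Polynomial.X) h).natTrailingDegree)) → (∃ C₁ C₂ : ℕ, ∀ (n : ℕ) (N d k : ℕ) (h : MvPolynomial (Fin N) ℝ) (e : Fin N → ℝ) (Φ : (Fin n × Fin n → Fin n × Fin n → Fin n × Fin n → ℂ) →ₗ[ℝ] (Fin N → ℝ)), 2 ≤ n → h.IsHomogeneous d → MvPolynomial.eval e h ≠ 0 → (∀ w : Fin N → ℝ, Multiset.card (MvPolynomial.aeval (fun i => Polynomial.C (w i) + Polynomial.C (e i) * Polynomial.X) h).roots = d) → (∀ u v : Fin N → ℝ, (d - (MvPolynomial.aeval (fun i => Polynomial.C ((u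 + v) i) + Polynomial.C (e i) * Polynomial.X) h).natTrailingDegree) ≤ (d - (MvPolynomial.aeval (fun i => Polynomial.C (u i) + Polynomial.C (e i) * Polynomial.X) h).natTrailingDegree) + (d - (MvPolynomial.aeval (fun i => Polynomial.C (v i) + Polynomial.C (e i) * Polynomial.X) h).natTrailingDegree)) → (∀ w u v : Fin n × Fin n → ℂ, (d - (MvPolynomial.aeval (fun i => Polynomial.C ((Φ (Literature.Computability.AlgebraicComplexity.triad w u v)) i) + Polynomial.C (e i) * Polynomial.X) h).natTrailingDegree) ≤ k) → 1 ≤ k → C₁ * k * n ^ 2 < (d - (MvPolynomial.aeval (fun i => Polynomial.C ((Φ (Literature.Computability.AlgebraicComplexity.matMulTensor ℂ n n n)) i) + Polynomial.C (e i) * Polynomial.X) h).natTrailingDegree) → ∃ (N' d' k' : ℕ) (h' : MvPolynomial (Fin N') ℝ) (e' : Fin N' → ℝ) (Φ' : (Fin (n ^ 2) × Fin (n ^ 2) → Fin (n ^ 2) × Fin (n ^ 2) → Fin (n ^ 2) × Fin (n ^ 2) → ℂ) →ₗ[ℝ] (Fin N' → ℝ)), h'.IsHomogeneous d' ∧ MvPolynomial.eval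 e' h' ≠ 0 ∧ (∀ w : Fin N' → ℝ, Multiset.card (MvPolynomial.aeval (fun i => Polynomial.C (w i) + Polynomial.C (e' i) * Polynomial.X) h').roots = d') ∧ (∀ u v : Fin N' → ℝ, (d' - (MvPolynomial.aeval (fun i => Polynomial.C ((u + v) i) + Polynomial.C (e' i) * Polynomial.X) h').natTrailingDegree) ≤ (d' - (MvPolynomial.aeval (fun i => Polynomial.C (u i) + Polynomial.C (e' i) * Polynomial.X) h').natTrailingDegree) + (d' - (MvPolynomial.aeval (fun i => Polynomial.C (v i) + Polynomial.C (e' i) * Polynomial.X) h').natTrailingDegree)) ∧ (∀ w u v : Fin (n ^ 2) × Fin (n ^ 2) → ℂ, (d' - (MvPolynomial.aeval (fun i => Polynomial.C ((Φ' (Literature.Computability.AlgebraicComplexity.triad w u v)) i) + Polynomial.C (e' i) * Polynomial.X) h').natTrailingDegree) ≤ k') ∧ 1 ≤ k' ∧ (d - (MvPolynomial.aeval (fun i => Polynomial.C ((Φ (Literature.Computability.AlgebraicComplexity.matMulTensor ℂ n n n)) i) + Polynomial.C (e i) * Polynomial.X) h).natTrailingDegree) ^ 2 * k' ≤ C₂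 * (d' - (MvPolynomial.aeval (fun i => Polynomial.C ((Φ' (Literature.Computability.AlgebraicComplexity.matMulTensor ℂ (n ^ 2) (n ^ 2) (n ^ 2))) i) + Polynomial.C (e' i) * Polynomial.X) h').natTrailingDegree) * k ^ 2) → HypQuotientSquaring := by
  intro hF hS
  obtain ⟨C₁, C₂, hS⟩ := hS
  unfold HypQuotientSquaring
  refine ⟨C₁ ^ 2 + C₂, ?_⟩
  intro n N d k h e Φ hn hhom he hroots hsub hone hk
  by_cases hreg : C₁ * k * n ^ 2 < (d - (MvPolynomial.aeval (fun i => Polynomial.C ((Φ (Literature.Computability.AlgebraicComplexity.matMulTensor ℂ n n n)) i) + Polynomial.C (e i) * Polynomial.X) h).natTrailingDegree)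
  · obtain ⟨N', d', k', h', e', Φ', hhom', he', hroots', hsub', hone', hk', hq⟩ :=
      hS n N d k h e Φ hn hhom he hroots hsub hone hk hreg
    refine ⟨N', d', k', h', e', Φ', hhom', he', hroots', hsub', hone', hk', ?_⟩
    exact hq.trans (Nat.mul_le_mul_right _ (Nat.mul_le_mul_right _ (Nat.le_add_left _ _)))
  · obtain ⟨N', d', k', h', e', Φ', hhom', he', hroots', hsub', hone', hk', hflat⟩ :=
      hF (n ^ 2) (Nat.one_le_pow _ _ (by omega))
    refine ⟨N', d', k', h', e', Φ', hhom', he', hroots', hsub', hone', hk', ?_⟩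
    rw [not_lt] at hreg
    generalize hr : (d - (MvPolynomial.aeval (fun i => Polynomial.C ((Φ (Literature.Computability.AlgebraicComplexity.matMulTensor ℂ n n n)) i) + Polynomial.C (e i) * Polynomial.X) h).natTrailingDegree) = r at hreg ⊢
    generalize hr' : (d' - (MvPolynomial.aeval (fun i => Polynomial.C ((Φ' (Literature.Computability.AlgebraicComplexity.matMulTensor ℂ (n ^ 2) (n ^ 2) (n ^ 2))) i) + Polynomial.C (e' i) * Polynomial.X) h').natTrailingDegree) = r' at hflat ⊢
    calc r ^ 2 * k' ≤ (C₁ * k * n ^ 2) ^ 2 * k' := Nat.mul_le_mul_right _ (Nat.pow_le_pow_left hreg 2)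
      _ = C₁ ^ 2 * (k' * (n ^ 2) ^ 2) * k ^ 2 := by ring
      _ ≤ C₁ ^ 2 * r' * k ^ 2 := by gcongr
      _ ≤ (C₁ ^ 2 + C₂) * r' * k ^ 2 := by gcongr; exact Nat.le_add_right _ _

/-- **THE SKELETON THEOREM.** The piece `HypQuotientSquaring` (stmt-MatrixMultiplication-17704) BY NAME from
the two DECLARED stubs `stub_flatteningMethod`, `stub_strongSquaring` (the file's only `sorry`s) through the
sorry-free composition `hypQuotientSquaring_of_regimes`. -/
theorem HypQuotientSquaring_of : HypQuotientSquaring :=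
  hypQuotientSquaring_of_regimes stub_flatteningMethod stub_strongSquaring

end Summit.MatrixMultiplication.MatrixMultiplication.Cruxes.HypSuperquadratic.SquaringRegimes
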